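import Summits.KontsevichZagierPeriods.KontsevichZagierPeriods.Theses.UnfoldedStokes
import Summits.KontsevichZagierPeriods.KontsevichZagierPeriods.Theorems.CompleteModGammaSector.Negative.ChangeOfVariables
import Summits.KontsevichZagierPeriods.KontsevichZagierPeriods.Theorems.CompleteModGammaSector.Negative.DomainAdditivity

/-!
# `StokesGeneration` (stmt-KontsevichZagierPeriods-3586) — rules (2) and (1a) are load-bearing

cdisprove (refuter) negative lemma for the crux `StokesGeneration` of route
`KontsevichZagierPeriods/UnfoldedStokes` (`ker eval ≤ relations ⊔ closure S`), transferring the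
tree's summit-level independence result for rule (2)
(`CompleteModGammaSectorNegative.not_periodConjecture_rulesOneThree`, invariant subgroup `covKer`:
formal combinations whose first-coordinate distribution function is `ℝ`-semialgebraic on the
window `[2,3]`) to the crux WITH its unfolded-Stokes square relators kept:

* `closure_stokesSquareRel_le_covKer` — every square relator lies in `covKer` (all six
  representations live over the open unit cube, first coordinate `< 1 ≤ 2`, so their distribution
  functions are constant on the window);
* `stokesGeneration_false_without_cov` — the crux with `changeOfVariablesRel` removed from the
  generators of `relations` (rules (1a), (1b), (3) and the square relators kept) is FALSE: the
  translation pair `[[0,1], 1/(2−t)] − [[2,3], 1/(4−t)]` (value `log 2` twice) is a kernel element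
  outside `covKer` (`witness_not_mem_covKer`: `1/(s−2)` has no `ℝ`-semialgebraic primitive).

And the same transfer for rule (1a), MODULO the tree's named fact `Dries1998_ch4_prop_2_4`
(invariance of the o-minimal Euler characteristic under injective definable maps, van den Dries
Ch. 4 (2.4); hypothesis `hE`), with the tree's Euler-parity-weighted evaluation `evenEulerEval`
(`CompleteModGammaSectorNegative.not_periodConjecture_rulesNoDomainAdd`):

* `closure_stokesSquareRel_le_ker_evenEulerEval` — UNCONDITIONAL: every square relator is killed by
  `evenEulerEval` (the open unit cubes have odd Euler characteristic `(−1)^k`);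
* `stokesGeneration_false_without_domainAdd hE` — the crux with `domainAddRel` removed (rules (1b),
  (2), (3) and the square relators kept) is false at the Euler witness
  `[[0,1] ∪ [2,3], 1] − [[0,2], 1]` (`evenEulerEval = 2`).

With `Negative/NewtonLeibnizLoadBearing.lean` (rule (3) load-bearing, unconditional) and
`Negative/IntegrandAddRedundant.lean` (rule (1b) redundant): any proof of the crux uses rules (2)
and (3), and — granting vdD (2.4) — rule (1a); rule (1b) it may avoid.

[Kontsevich–Zagier 2001, §1.2 rules (1)–(3), Conjecture 1]
-/

noncomputable section

namespace Summit.KontsevichZagierPeriods.UnfoldedStokes.StokesGenerationNegative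

open MeasureTheory Set
open Literature.NumberTheory.Transcendental
open Literature.NumberTheory.Transcendental.KZ
open Literature.ModelTheory.ExponentialFields (IsSemialgebraic)
open Summit.KontsevichZagierPeriods.CompleteModGammaSectorNegative
  (Cdf covKer mem_covKer_iff Cdf_of_eq_value WindowSemialg rulesOneThree rulesOneThree_le_covKer
    r₀ r₀' r₀_value_eq witness_not_mem_covKer realEuler odd_realEuler_cube evenEulerEval
    evenEulerEval_of rulesNoDomainAdd rulesNoDomainAdd_le_ker twoIntervalsRep oneIntervalRep
    euler_witness_value_eq evenEulerEval_witness)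
open Literature.ModelTheory.ExponentialFields (Dries1998_ch4_prop_2_4)

/-- A positive-dimensional representation whose domain lies in the half-space `{x₀ ≤ 2}` lies in
`covKer`: its distribution function is constant (`= value`) on the window `[2,3]`. [folklore] -/
theorem of_mem_covKer_of_first_le_two {n : ℕ} (hn : 0 < n) (r : IntegralRep n)
    (h : ∀ x ∈ r.domain, x ⟨0, hn⟩ ≤ 2) : of r ∈ covKer := by
  rw [mem_covKer_iff]
  refine WindowSemialg.of_const r.value fun s hs => ?_
  exact Cdf_of_eq_value hn r (2 + s) fun x hx => (h x hx).trans (by linarith [hs.1])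

/-- A representation on the open unit square lies in `covKer`. [folklore] -/
theorem of_mem_covKer_of_domain_two (r : IntegralRep 2)
    (hr : r.domain = {x | ∀ i, x i ∈ Set.Ioo (0 : ℝ) 1}) : of r ∈ covKer :=
  of_mem_covKer_of_first_le_two two_pos r fun x hx => by
    rw [hr] at hx
    have := (hx ⟨0, two_pos⟩).2
    linarith

/-- A representation on the open unit cube of `ℝ³` lies in `covKer`. [folklore] -/
theorem of_mem_covKer_of_domain_three (r : IntegralRep 3)
    (hr : r.domain = {x | ∀ i, x i ∈ Set.Ioo (0 : ℝ) 1}) : of r ∈ covKer :=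
  of_mem_covKer_of_first_le_two three_pos r fun x hx => by
    rw [hr] at hx
    have := (hx ⟨0, three_pos⟩).2
    linarith

/-- **Every unfolded-Stokes square relator of the crux lies in `covKer`** (the set is the crux's,
verbatim). [folklore] -/
theorem closure_stokesSquareRel_le_covKer :
    AddSubgroup.closure {d : FormalRep | ∃ (U : Set (Fin 2 → ℝ)) (a b c e : (Fin 2 → ℝ) → ℝ)
      (rB rR rT rL rW : IntegralRep 2) (rD : IntegralRep 3),
      (IsOpen U) ∧ (Set.Icc (0 : Fin 2 → ℝ) 1 ⊆ U) ∧ (∀ p ∈ U, ∀ u ∈ Set.Icc (0 : ℝ) 1, u • p ∈ U) ∧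
      (ContDiffOn ℝ 1 a U) ∧ (ContDiffOn ℝ 1 b U) ∧ (ContDiffOn ℝ 1 c U) ∧ (ContDiffOn ℝ 1 e U) ∧
      (∀ p ∈ U, fderiv ℝ a p (Pi.single 1 1) = fderiv ℝ b p (Pi.single 0 1)) ∧
      (IsSemialgebraicFunOn ℚ U a) ∧ (IsSemialgebraicFunOn ℚ U b) ∧ (IsSemialgebraicFunOn ℚ U c) ∧
      (IsSemialgebraicFunOn ℚ U e) ∧
      (IsSemialgebraicFunOn ℚ U (fun p => fderiv ℝ a p (Pi.single 0 1))) ∧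
      (IsSemialgebraicFunOn ℚ U (fun p => fderiv ℝ a p (Pi.single 1 1))) ∧
      (IsSemialgebraicFunOn ℚ U (fun p => fderiv ℝ b p (Pi.single 1 1))) ∧
      (IsSemialgebraicFunOn ℚ U (fun p => fderiv ℝ c p (Pi.single 1 1))) ∧
      (IsSemialgebraicFunOn ℚ U (fun p => fderiv ℝ e p (Pi.single 0 1))) ∧
      (rB.domain = {x | ∀ i, x i ∈ Set.Ioo (0 : ℝ) 1}) ∧
      (Set.EqOn rB.integrand (fun x => x 0 * a ![x 1 * x 0, 0] * c ![x 0, 0]) rB.domain) ∧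
      (rR.domain = {x | ∀ i, x i ∈ Set.Ioo (0 : ℝ) 1}) ∧
      (Set.EqOn rR.integrand (fun x => (a ![x 1, x 1 * x 0] + x 0 * b ![x 1, x 1 * x 0]) * e ![1, x 0])
        rR.domain) ∧
      (rT.domain = {x | ∀ i, x i ∈ Set.Ioo (0 : ℝ) 1}) ∧
      (Set.EqOn rT.integrand (fun x => (x 0 * a ![x 1 * x 0, x 1] + b ![x 1 * x 0, x 1]) * c ![x 0, 1])
        rT.domain) ∧
      (rL.domain = {x | ∀ i, x i ∈ Set.Ioo (0 : ℝ) 1}) ∧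
      (Set.EqOn rL.integrand (fun x => x 0 * b ![0, x 1 * x 0] * e ![0, x 0]) rL.domain) ∧
      (rW.domain = {x | ∀ i, x i ∈ Set.Ioo (0 : ℝ) 1}) ∧
      (Set.EqOn rW.integrand (fun x => a ![x 0, x 1] * e ![x 0, x 1] - b ![x 0, x 1] * c ![x 0, x 1])
        rW.domain) ∧
      (rD.domain = {x | ∀ i, x i ∈ Set.Ioo (0 : ℝ) 1}) ∧
      (Set.EqOn rD.integrand (fun x => (x 0 * a ![x 2 * x 0, x 2 * x 1] + x 1 * b ![x 2 * x 0, x 2 * x 1]) *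
        (fderiv ℝ e ![x 0, x 1] (Pi.single 0 1) - fderiv ℝ c ![x 0, x 1] (Pi.single 1 1))) rD.domain) ∧
      d = of rB + of rR - of rT - of rL - of rW - of rD} ≤ covKer := by
  refine (AddSubgroup.closure_le _).mpr ?_
  rintro d ⟨U, a, b, c, e, rB, rR, rT, rL, rW, rD, -, -, -, -, -, -, -, -, -, -, -, -, -, -, -, -, -,
    hBd, -, hRd, -, hTd, -, hLd, -, hWd, -, hDd, -, rfl⟩
  exact covKer.sub_mem (covKer.sub_mem (covKer.sub_mem (covKer.sub_mem
    (covKer.add_mem (of_mem_covKer_of_domain_two rB hBd) (of_mem_covKer_of_domain_two rR hRd))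
    (of_mem_covKer_of_domain_two rT hTd)) (of_mem_covKer_of_domain_two rL hLd))
    (of_mem_covKer_of_domain_two rW hWd)) (of_mem_covKer_of_domain_three rD hDd)

/-- **Rule (2) (change of variables) is load-bearing for the crux `StokesGeneration`**, even in the
presence of the square relators: with `changeOfVariablesRel` removed from the generators of
`relations` the statement fails at the translation pair `[[0,1], 1/(2−t)] − [[2,3], 1/(4−t)]`
(a kernel element: both values are `log 2`), which lies outside the invariant subgroup `covKer`
containing rules (1a), (1b), (3) and every square relator. [cite: KontsevichZagier2001, §1.2] -/
theorem stokesGeneration_false_without_cov :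
    ¬ (∀ x : FormalRep, eval x = 0 →
      x ∈ AddSubgroup.closure (domainAddRel ∪ integrandAddRel ∪ newtonLeibnizRel) ⊔
        AddSubgroup.closure {d : FormalRep | ∃ (U : Set (Fin 2 → ℝ)) (a b c e : (Fin 2 → ℝ) → ℝ)
      (rB rR rT rL rW : IntegralRep 2) (rD : IntegralRep 3),
      (IsOpen U) ∧ (Set.Icc (0 : Fin 2 → ℝ) 1 ⊆ U) ∧ (∀ p ∈ U, ∀ u ∈ Set.Icc (0 : ℝ) 1, u • p ∈ U) ∧
      (ContDiffOn ℝ 1 a U) ∧ (ContDiffOn ℝ 1 b U) ∧ (ContDiffOn ℝ 1 c U) ∧ (ContDiffOn ℝ 1 e U) ∧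
      (∀ p ∈ U, fderiv ℝ a p (Pi.single 1 1) = fderiv ℝ b p (Pi.single 0 1)) ∧
      (IsSemialgebraicFunOn ℚ U a) ∧ (IsSemialgebraicFunOn ℚ U b) ∧ (IsSemialgebraicFunOn ℚ U c) ∧
      (IsSemialgebraicFunOn ℚ U e) ∧
      (IsSemialgebraicFunOn ℚ U (fun p => fderiv ℝ a p (Pi.single 0 1))) ∧
      (IsSemialgebraicFunOn ℚ U (fun p => fderiv ℝ a p (Pi.single 1 1))) ∧
      (IsSemialgebraicFunOn ℚ U (fun p => fderiv ℝ b p (Pi.single 1 1))) ∧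
      (IsSemialgebraicFunOn ℚ U (fun p => fderiv ℝ c p (Pi.single 1 1))) ∧
      (IsSemialgebraicFunOn ℚ U (fun p => fderiv ℝ e p (Pi.single 0 1))) ∧
      (rB.domain = {x | ∀ i, x i ∈ Set.Ioo (0 : ℝ) 1}) ∧
      (Set.EqOn rB.integrand (fun x => x 0 * a ![x 1 * x 0, 0] * c ![x 0, 0]) rB.domain) ∧
      (rR.domain = {x | ∀ i, x i ∈ Set.Ioo (0 : ℝ) 1}) ∧
      (Set.EqOn rR.integrand (fun x => (a ![x 1, x 1 * x 0] + x 0 * b ![x 1, x 1 * x 0]) * e ![1, x 0])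
        rR.domain) ∧
      (rT.domain = {x | ∀ i, x i ∈ Set.Ioo (0 : ℝ) 1}) ∧
      (Set.EqOn rT.integrand (fun x => (x 0 * a ![x 1 * x 0, x 1] + b ![x 1 * x 0, x 1]) * c ![x 0, 1])
        rT.domain) ∧
      (rL.domain = {x | ∀ i, x i ∈ Set.Ioo (0 : ℝ) 1}) ∧
      (Set.EqOn rL.integrand (fun x => x 0 * b ![0, x 1 * x 0] * e ![0, x 0]) rL.domain) ∧
      (rW.domain = {x | ∀ i, x i ∈ Set.Ioo (0 : ℝ) 1}) ∧
      (Set.EqOn rW.integrand (fun x => a ![x 0, x 1] * e ![x 0, x 1] - b ![x 0, x 1] * c ![x 0, x 1])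
        rW.domain) ∧
      (rD.domain = {x | ∀ i, x i ∈ Set.Ioo (0 : ℝ) 1}) ∧
      (Set.EqOn rD.integrand (fun x => (x 0 * a ![x 2 * x 0, x 2 * x 1] + x 1 * b ![x 2 * x 0, x 2 * x 1]) *
        (fderiv ℝ e ![x 0, x 1] (Pi.single 0 1) - fderiv ℝ c ![x 0, x 1] (Pi.single 1 1))) rD.domain) ∧
      d = of rB + of rR - of rT - of rL - of rW - of rD}) := by
  intro h
  have hw : eval (of r₀ - of r₀') = 0 := by
    rw [map_sub, eval_of, eval_of, r₀_value_eq, sub_self]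
  have h13 : AddSubgroup.closure (domainAddRel ∪ integrandAddRel ∪ newtonLeibnizRel) ≤ covKer :=
    rulesOneThree_le_covKer
  exact witness_not_mem_covKer ((sup_le h13 closure_stokesSquareRel_le_covKer) (h _ hw))

/-! ## Rule (1a): domain additivity (modulo van den Dries Ch. 4 (2.4)) -/

/-- A representation on an open unit cube is killed by the Euler-parity-weighted evaluation
(`E((0,1)^k) = (−1)^k` is odd; unconditional). [folklore] -/
theorem evenEulerEval_of_eq_zero_of_domain {k : ℕ} (r : IntegralRep k)
    (hr : r.domain = {x | ∀ i, x i ∈ Set.Ioo (0 : ℝ) 1}) : evenEulerEval (of r) = 0 := by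
  have h1 : ¬ Even (realEuler k r.domain) := by
    rw [hr, Int.not_even_iff_odd]
    exact odd_realEuler_cube k
  rw [evenEulerEval_of, if_neg h1]

/-- **Every unfolded-Stokes square relator is killed by `evenEulerEval`** (unconditional).
[folklore] -/
theorem closure_stokesSquareRel_le_ker_evenEulerEval :
    AddSubgroup.closure {d : FormalRep | ∃ (U : Set (Fin 2 → ℝ)) (a b c e : (Fin 2 → ℝ) → ℝ)
      (rB rR rT rL rW : IntegralRep 2) (rD : IntegralRep 3),
      (IsOpen U) ∧ (Set.Icc (0 : Fin 2 → ℝ) 1 ⊆ U) ∧ (∀ p ∈ U, ∀ u ∈ Set.Icc (0 : ℝ) 1, u • p ∈ U) ∧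
      (ContDiffOn ℝ 1 a U) ∧ (ContDiffOn ℝ 1 b U) ∧ (ContDiffOn ℝ 1 c U) ∧ (ContDiffOn ℝ 1 e U) ∧
      (∀ p ∈ U, fderiv ℝ a p (Pi.single 1 1) = fderiv ℝ b p (Pi.single 0 1)) ∧
      (IsSemialgebraicFunOn ℚ U a) ∧ (IsSemialgebraicFunOn ℚ U b) ∧ (IsSemialgebraicFunOn ℚ U c) ∧
      (IsSemialgebraicFunOn ℚ U e) ∧
      (IsSemialgebraicFunOn ℚ U (fun p => fderiv ℝ a p (Pi.single 0 1))) ∧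
      (IsSemialgebraicFunOn ℚ U (fun p => fderiv ℝ a p (Pi.single 1 1))) ∧
      (IsSemialgebraicFunOn ℚ U (fun p => fderiv ℝ b p (Pi.single 1 1))) ∧
      (IsSemialgebraicFunOn ℚ U (fun p => fderiv ℝ c p (Pi.single 1 1))) ∧
      (IsSemialgebraicFunOn ℚ U (fun p => fderiv ℝ e p (Pi.single 0 1))) ∧
      (rB.domain = {x | ∀ i, x i ∈ Set.Ioo (0 : ℝ) 1}) ∧
      (Set.EqOn rB.integrand (fun x => x 0 * a ![x 1 * x 0, 0] * c ![x 0, 0]) rB.domain) ∧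
      (rR.domain = {x | ∀ i, x i ∈ Set.Ioo (0 : ℝ) 1}) ∧
      (Set.EqOn rR.integrand (fun x => (a ![x 1, x 1 * x 0] + x 0 * b ![x 1, x 1 * x 0]) * e ![1, x 0])
        rR.domain) ∧
      (rT.domain = {x | ∀ i, x i ∈ Set.Ioo (0 : ℝ) 1}) ∧
      (Set.EqOn rT.integrand (fun x => (x 0 * a ![x 1 * x 0, x 1] + b ![x 1 * x 0, x 1]) * c ![x 0, 1])
        rT.domain) ∧
      (rL.domain = {x | ∀ i, x i ∈ Set.Ioo (0 : ℝ) 1}) ∧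
      (Set.EqOn rL.integrand (fun x => x 0 * b ![0, x 1 * x 0] * e ![0, x 0]) rL.domain) ∧
      (rW.domain = {x | ∀ i, x i ∈ Set.Ioo (0 : ℝ) 1}) ∧
      (Set.EqOn rW.integrand (fun x => a ![x 0, x 1] * e ![x 0, x 1] - b ![x 0, x 1] * c ![x 0, x 1])
        rW.domain) ∧
      (rD.domain = {x | ∀ i, x i ∈ Set.Ioo (0 : ℝ) 1}) ∧
      (Set.EqOn rD.integrand (fun x => (x 0 * a ![x 2 * x 0, x 2 * x 1] + x 1 * b ![x 2 * x 0, x 2 * x 1]) *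
        (fderiv ℝ e ![x 0, x 1] (Pi.single 0 1) - fderiv ℝ c ![x 0, x 1] (Pi.single 1 1))) rD.domain) ∧
      d = of rB + of rR - of rT - of rL - of rW - of rD} ≤ evenEulerEval.ker := by
  refine (AddSubgroup.closure_le _).mpr ?_
  rintro d ⟨U, a, b, c, e, rB, rR, rT, rL, rW, rD, -, -, -, -, -, -, -, -, -, -, -, -, -, -, -, -, -,
    hBd, -, hRd, -, hTd, -, hLd, -, hWd, -, hDd, -, rfl⟩
  simp only [SetLike.mem_coe, AddMonoidHom.mem_ker, map_sub, map_add,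
    evenEulerEval_of_eq_zero_of_domain rB hBd, evenEulerEval_of_eq_zero_of_domain rR hRd,
    evenEulerEval_of_eq_zero_of_domain rT hTd, evenEulerEval_of_eq_zero_of_domain rL hLd,
    evenEulerEval_of_eq_zero_of_domain rW hWd, evenEulerEval_of_eq_zero_of_domain rD hDd,
    add_zero, sub_zero]

/-- **Rule (1a) (domain additivity) is load-bearing for the crux `StokesGeneration`, modulo
van den Dries Ch. 4 (2.4)** (`hE`, the tree's named fact `Dries1998_ch4_prop_2_4`; needed only for
the invariance of `evenEulerEval` under rule (2)): with `domainAddRel` removed from the generators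
of `relations` the statement fails at the Euler witness `[[0,1] ∪ [2,3], 1] − [[0,2], 1]`
(value `2` twice, `evenEulerEval = 2`). [cite: Dries1998, Ch. 4 (2.4)] -/
theorem stokesGeneration_false_without_domainAdd
    (hE : Dries1998_ch4_prop_2_4 Literature.ModelTheory.ExponentialFields.Language.orderedRing ℝ) :
    ¬ (∀ x : FormalRep, eval x = 0 →
      x ∈ AddSubgroup.closure (integrandAddRel ∪ changeOfVariablesRel ∪ newtonLeibnizRel) ⊔
        AddSubgroup.closure {d : FormalRep | ∃ (U : Set (Fin 2 → ℝ)) (a b c e : (Fin 2 → ℝ) → ℝ)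
      (rB rR rT rL rW : IntegralRep 2) (rD : IntegralRep 3),
      (IsOpen U) ∧ (Set.Icc (0 : Fin 2 → ℝ) 1 ⊆ U) ∧ (∀ p ∈ U, ∀ u ∈ Set.Icc (0 : ℝ) 1, u • p ∈ U) ∧
      (ContDiffOn ℝ 1 a U) ∧ (ContDiffOn ℝ 1 b U) ∧ (ContDiffOn ℝ 1 c U) ∧ (ContDiffOn ℝ 1 e U) ∧
      (∀ p ∈ U, fderiv ℝ a p (Pi.single 1 1) = fderiv ℝ b p (Pi.single 0 1)) ∧
      (IsSemialgebraicFunOn ℚ U a) ∧ (IsSemialgebraicFunOn ℚ U b) ∧ (IsSemialgebraicFunOn ℚ U c) ∧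
      (IsSemialgebraicFunOn ℚ U e) ∧
      (IsSemialgebraicFunOn ℚ U (fun p => fderiv ℝ a p (Pi.single 0 1))) ∧
      (IsSemialgebraicFunOn ℚ U (fun p => fderiv ℝ a p (Pi.single 1 1))) ∧
      (IsSemialgebraicFunOn ℚ U (fun p => fderiv ℝ b p (Pi.single 1 1))) ∧
      (IsSemialgebraicFunOn ℚ U (fun p => fderiv ℝ c p (Pi.single 1 1))) ∧
      (IsSemialgebraicFunOn ℚ U (fun p => fderiv ℝ e p (Pi.single 0 1))) ∧
      (rB.domain = {x | ∀ i, x i ∈ Set.Ioo (0 : ℝ) 1}) ∧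
      (Set.EqOn rB.integrand (fun x => x 0 * a ![x 1 * x 0, 0] * c ![x 0, 0]) rB.domain) ∧
      (rR.domain = {x | ∀ i, x i ∈ Set.Ioo (0 : ℝ) 1}) ∧
      (Set.EqOn rR.integrand (fun x => (a ![x 1, x 1 * x 0] + x 0 * b ![x 1, x 1 * x 0]) * e ![1, x 0])
        rR.domain) ∧
      (rT.domain = {x | ∀ i, x i ∈ Set.Ioo (0 : ℝ) 1}) ∧
      (Set.EqOn rT.integrand (fun x => (x 0 * a ![x 1 * x 0, x 1] + b ![x 1 * x 0, x 1]) * c ![x 0, 1])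
        rT.domain) ∧
      (rL.domain = {x | ∀ i, x i ∈ Set.Ioo (0 : ℝ) 1}) ∧
      (Set.EqOn rL.integrand (fun x => x 0 * b ![0, x 1 * x 0] * e ![0, x 0]) rL.domain) ∧
      (rW.domain = {x | ∀ i, x i ∈ Set.Ioo (0 : ℝ) 1}) ∧
      (Set.EqOn rW.integrand (fun x => a ![x 0, x 1] * e ![x 0, x 1] - b ![x 0, x 1] * c ![x 0, x 1])
        rW.domain) ∧
      (rD.domain = {x | ∀ i, x i ∈ Set.Ioo (0 : ℝ) 1}) ∧
      (Set.EqOn rD.integrand (fun x => (x 0 * a ![x 2 * x 0, x 2 * x 1] + x 1 * b ![x 2 * x 0, x 2 * x 1]) *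
        (fderiv ℝ e ![x 0, x 1] (Pi.single 0 1) - fderiv ℝ c ![x 0, x 1] (Pi.single 1 1))) rD.domain) ∧
      d = of rB + of rR - of rT - of rL - of rW - of rD}) := by
  intro h
  have hw : eval (of twoIntervalsRep - of oneIntervalRep) = 0 := by
    rw [map_sub, eval_of, eval_of, euler_witness_value_eq, sub_self]
  have h23 : AddSubgroup.closure (integrandAddRel ∪ changeOfVariablesRel ∪ newtonLeibnizRel) ≤
      evenEulerEval.ker := rulesNoDomainAdd_le_ker hE
  have h0 := (sup_le h23 closure_stokesSquareRel_le_ker_evenEulerEval) (h _ hw)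
  rw [AddMonoidHom.mem_ker, evenEulerEval_witness] at h0
  norm_num at h0

end Summit.KontsevichZagierPeriods.UnfoldedStokes.StokesGenerationNegative
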